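import Summits.Ventures.PercRepro.MSTightTwinFreeProduct

/-!
# Killing differences from below in a tight twin-free family

Dossier proofs/MINE1-theoremS.md, Addendum 48 §6 (Theorem 2, the bound). Let `P` be a tight
twin-free family and `M ⊆ P`. A difference `w` of `P` is **killed from below** by `M` when every
member of `P` disjoint from `w` lies in `M` (`killed P M`). Since in a tight twin-free family
every member `b` disjoint from a difference `w` realises it — `a := w ∪ (b ∩ R*(P))` is a member
with `a \ b = w` (`exists_sdiff_eq_of_disjoint`, the realisation from below of Addendum 45 §1) —
the differences of `P` against `P \ M` are exactly the differences not killed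
(`diffs_sdiff_eq_diffs_sdiff_killed`), and Daykin's inequality for the pair `(P, P \ M)` gives
**`|killed P M| ≤ |M|`** (`card_killed_le`). In Addendum 48 this is the count `|𝒦(M)| ≤ |M|`
behind the three cases of the F̂-tight normal form; the paper obtains it from Marica–Schönheim for
the free extension `(P \ M) ∪ (P + r')`, the kernel proof below avoids the new element.
-/

namespace PercRepro.MSTight

open Finset
open scoped FinsetFamily

variable {α : Type*} [DecidableEq α] [Fintype α]

section Killer

variable {P : Finset (Finset α)} (hP : Tight P) (htf : ∀ a b, Twin P a b → a = b)
include hP htf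

/-- **Realisation from below.** In a tight twin-free family, a member `b` disjoint from a
difference `w` realises it: `a := w ∪ (b ∩ R*(P))` is a member with `a \ b = w`. -/
theorem exists_sdiff_eq_of_disjoint {w b : Finset α} (hw : w ∈ P \\ P) (hb : b ∈ P)
    (hwb : Disjoint w b) : ∃ a ∈ P, a \ b = w := by
  have hD : IsDownSet (P \\ P) := isDownSet_diffs_of_twinFree hP htf
  obtain ⟨_, hb2⟩ := (mem_iff_parts hP).1 hb
  refine ⟨w ∪ (b ∩ Rstar P), ?_, ?_⟩
  · rw [mem_iff_parts hP]
    constructor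
    · refine hD _ hw _ ?_
      intro x hx
      simp only [mem_sdiff, mem_union, mem_inter] at hx
      tauto
    · refine hD _ hb2 _ ?_
      intro x hx
      rw [mem_sdiff] at hx ⊢
      refine ⟨hx.1, fun hxb => hx.2 ?_⟩
      simp only [mem_union, mem_inter]
      exact Or.inr ⟨hxb, hx.1⟩
  · ext x
    simp only [mem_sdiff, mem_union, mem_inter]
    constructor
    · rintro ⟨h | h, hxb⟩
      · exact h
      · exact absurd h.1 hxb
    · intro hxw
      exact ⟨Or.inl hxw, disjoint_left.1 hwb hxw⟩

omit hP htf in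
/-- The differences of `P` **killed from below** by `M`: every member of `P` disjoint from `w`
lies in `M`. -/
def killed (P M : Finset (Finset α)) : Finset (Finset α) :=
  (P \\ P).filter fun w => ∀ b ∈ P, Disjoint w b → b ∈ M

omit hP htf in
/-- Membership in `killed P M`. -/
theorem mem_killed {M : Finset (Finset α)} {w : Finset α} :
    w ∈ killed P M ↔ w ∈ P \\ P ∧ ∀ b ∈ P, Disjoint w b → b ∈ M := by
  unfold killed
  exact mem_filter

omit hP htf in
/-- Killed differences are differences. -/
theorem killed_subset_diffs (M : Finset (Finset α)) : killed P M ⊆ P \\ P :=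
  filter_subset _ _

/-- The differences of `P` against `P \ M` are the differences of `P` not killed by `M`. -/
theorem diffs_sdiff_eq_diffs_sdiff_killed (M : Finset (Finset α)) :
    P \\ (P \ M) = (P \\ P) \ killed P M := by
  ext w
  simp only [mem_diffs, mem_sdiff, mem_killed, not_and, not_forall, exists_prop]
  constructor
  · rintro ⟨a, ha, b, ⟨hbP, hbM⟩, rfl⟩
    exact ⟨⟨a, ha, b, hbP, rfl⟩, fun _ => ⟨b, hbP, disjoint_sdiff_self_left, hbM⟩⟩
  · rintro ⟨hw, h⟩
    obtain ⟨b, hbP, hwb, hbM⟩ := h hw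
    obtain ⟨a, ha, hab⟩ := exists_sdiff_eq_of_disjoint hP htf (mem_diffs.2 hw) hbP hwb
    exact ⟨a, ha, b, ⟨hbP, hbM⟩, hab⟩

/-- **At most `|M|` differences are killed from below by `M`** (Daykin's inequality for the
pair `(P, P \ M)`). -/
theorem card_killed_le {M : Finset (Finset α)} (hM : M ⊆ P) : (killed P M).card ≤ M.card := by
  have hD := le_card_diffs_mul_card_diffs P (P \ M)
  have h1 : (P \\ (P \ M)).card + (killed P M).card = (P \\ P).card := by
    rw [diffs_sdiff_eq_diffs_sdiff_killed hP htf]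
    exact card_sdiff_add_card_eq_card (killed_subset_diffs M)
  have h2 : ((P \ M) \\ P).card ≤ (P \\ P).card :=
    card_le_card (diffs_subset_right sdiff_subset)
  have h3 : (P \ M).card + M.card = P.card := card_sdiff_add_card_eq_card hM
  unfold Tight at hP
  rcases Nat.eq_zero_or_pos P.card with h0 | hpos
  · have : (killed P M).card = 0 := by
      have hk := card_le_card (killed_subset_diffs (P := P) M)
      omega
    omega
  · have h4 : P.card * (P \ M).card ≤ (P \\ (P \ M)).card * P.card := by
      calc P.card * (P \ M).card ≤ (P \\ (P \ M)).card * ((P \ M) \\ P).card := hD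
        _ ≤ (P \\ (P \ M)).card * P.card := by
          apply Nat.mul_le_mul_left
          omega
    have h5 : (P \ M).card ≤ (P \\ (P \ M)).card := by
      rw [mul_comm] at h4
      exact Nat.le_of_mul_le_mul_right h4 hpos
    omega

end Killer

end PercRepro.MSTight
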